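import Summits.KontsevichZagierPeriods.Zeta5Search.WedgeDictionaryLevelDescentVFull
import HarnessLib

/-!
# Level descent for `U ∧ V` on the unclean cone — §E (evaluations): factorial forms of `Ω(a;−1)`, `k₅(1)`, `η(a)` (gen-1 g8)

HONEST FRAMING: systematic search; no irrationality claim unless certified.

Companion to `WedgeDictionaryLevelDescentVFullBoundary` / `WedgeDictionaryLevelDescentVFull` (the kernel-checked reduction
`levelDescentVFull ⇐ ldSE_rowSource_stmt` (T3)).  This file holds the elementary EVALUATIONS used by the first proved instance of (T3)
(`WedgeDictionaryLevelDescentVFullLayer0`): the `m`-step of the symmetric weight from `m = 0` to `m = −1` on the layer `σ = N − 1`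
(`ldWeightSym_neg_one`), the level-5 kernel at `x = 1` in factorials (`kernel5_one`: `k₅(1)·∏_{j∈B}(N+1−b_j)! = (N+2)·∏_{j∈B} b_j!`),
and the row source `η(a)` in factorials (`rowEta_fac`: `η(a)·∏_j (N − a_j)! = ∏_j a_j!·N!`, via the face telescoper at `1`,
re-proving `CFW3.hPoly_eval_one` of `WedgeDictionaryRankThreeProof` to keep the import list short).  Pure bookkeeping over
`facQ`, `BallRivoal.poch`; no new notions.  Memo: `HOME/pub-zeta5-gen-1/D2-VFULL-PROOF-g8.md` §8.5.
-/

open Finset Polynomial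

namespace Summit.KontsevichZagierPeriods.Zeta5Search.WedgeDictionary

open Summit.KontsevichZagierPeriods.Zeta5Search.DualSeries
open Literature.NumberTheory.Transcendental
open Literature.NumberTheory.Transcendental.BallRivoal (poch poch_natCast_succ)

/-- `facQ (−1) = 1`. -/
theorem facQ_neg_one : facQ (-1) = 1 := by simp [facQ]

/-- `facQ 1 = 1`. -/
theorem facQ_one : facQ 1 = 1 := by simp [facQ]

/-- `facQ z ≠ 0`. -/
theorem facQ_ne_zero (z : ℤ) : facQ z ≠ 0 := by
  unfold facQ; exact_mod_cast (Nat.factorial_pos _).ne'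

/-- Denominator `m`-step `0 → −1` on the layer `σ = N − 1`. -/
theorem ldDen_neg_one (a : ℕ → ℤ) (h1 : 0 ≤ a 1) (h2 : 0 ≤ a 2) (h7 : 0 ≤ a 7)
    (hS : 0 ≤ 2 * a 0 - sumB a) (hσ : sigmaT a + 1 = a 0) :
    ldDen a (-1) = ldDen a 0 * (((a 1 : ℚ) + 1) * ((a 2 : ℚ) + 1) * ((a 7 : ℚ) + 1) * (2 * (a 0 : ℚ) - sumB a + 1)) := by
  unfold ldDen
  have e0 : a 0 + -1 - sigmaT a = 0 := by omega
  have e1 : a 0 + 0 - sigmaT a = 1 := by omega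
  rw [e0, e1]
  simp only [sub_neg_eq_add, sub_zero, facQ_zero, facQ_one, facQ_neg_one]
  rw [facQ_succ h1, facQ_succ h2, facQ_succ h7, facQ_succ hS]
  push_cast
  ring

/-- Numerator `m`-step `0 → −1`. -/
theorem ldNum_neg_one (a : ℕ → ℤ) (h3 : 0 ≤ a 0 - a 3) (h4 : 0 ≤ a 0 - a 4) (h5 : 0 ≤ a 0 - a 5) (h6 : 0 ≤ a 0 - a 6) :
    ldNum a (-1) = ldNum a 0 * (((a 0 : ℚ) - a 3 + 1) * ((a 0 : ℚ) - a 4 + 1) * ((a 0 : ℚ) - a 5 + 1) * ((a 0 : ℚ) - a 6 + 1)) := by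
  unfold ldNum
  simp only [sub_neg_eq_add, sub_zero]
  rw [facQ_succ h3, facQ_succ h4, facQ_succ h5, facQ_succ h6]
  push_cast
  ring

/-- The symmetric weight one step below the clean range, on the layer `σ = N − 1`:
`Ω(a;−1)·(a₁+1)(a₂+1)(a₇+1)(2N−ΣB+1) = −Ω(a;0)·∏_{j∈B}(N−a_j+1)`. -/
theorem ldWeightSym_neg_one (a : ℕ → ℤ) (h1 : 0 ≤ a 1) (h2 : 0 ≤ a 2) (h7 : 0 ≤ a 7)
    (h3 : 0 ≤ a 0 - a 3) (h4 : 0 ≤ a 0 - a 4) (h5 : 0 ≤ a 0 - a 5) (h6 : 0 ≤ a 0 - a 6)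
    (hS : 0 ≤ 2 * a 0 - sumB a) (hσ : sigmaT a + 1 = a 0) :
    ldWeightSym a (-1) * (((a 1 : ℚ) + 1) * ((a 2 : ℚ) + 1) * ((a 7 : ℚ) + 1) * (2 * (a 0 : ℚ) - sumB a + 1)) =
      -(ldWeightSym a 0 * (((a 0 : ℚ) - a 3 + 1) * ((a 0 : ℚ) - a 4 + 1) * ((a 0 : ℚ) - a 5 + 1) * ((a 0 : ℚ) - a 6 + 1))) := by
  rw [ldWeightSym_eq, ldWeightSym_eq, ldDen_neg_one a h1 h2 h7 hS hσ, ldNum_neg_one a h3 h4 h5 h6]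
  have hsign : (-1 : ℚ) ^ ((-1 : ℤ) + sumB a) = -((-1 : ℚ) ^ ((0 : ℤ) + sumB a)) := by
    rw [zero_add, zpow_add₀ (by norm_num : (-1 : ℚ) ≠ 0)]
    norm_num
  rw [hsign]
  have hD : ldDen a 0 ≠ 0 := ldDen_ne_zero a 0
  have h1' : (0 : ℚ) ≤ a 1 := by exact_mod_cast h1
  have h2' : (0 : ℚ) ≤ a 2 := by exact_mod_cast h2
  have h7' : (0 : ℚ) ≤ a 7 := by exact_mod_cast h7
  have hS' : (0 : ℚ) ≤ 2 * (a 0 : ℚ) - sumB a := by exact_mod_cast hS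
  have hq1 : (a 1 : ℚ) + 1 ≠ 0 := by positivity
  have hq2 : (a 2 : ℚ) + 1 ≠ 0 := by positivity
  have hq7 : (a 7 : ℚ) + 1 ≠ 0 := by positivity
  have hqS : 2 * (a 0 : ℚ) - sumB a + 1 ≠ 0 := by
    have : (0 : ℚ) < 2 * (a 0 : ℚ) - sumB a + 1 := by linarith
    exact this.ne'
  field_simp

/-- `pochQ = poch` (same product). -/
theorem pochQ_eq_poch (x : ℚ) (n : ℕ) : pochQ x n = poch x n := rfl

/-- `(1)_n = n!`. -/
theorem poch_one_eq_factorial (n : ℕ) : poch (1 : ℚ) n = (n.factorial : ℚ) := by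
  have := poch_natCast_succ 0 n
  simp only [Nat.cast_zero, zero_add, Nat.choose_self, Nat.cast_one, mul_one] at this
  exact this

/-- `(K+1)_m · K! = (K+m)!`. -/
theorem poch_succ_mul_factorial (K m : ℕ) : poch ((K : ℚ) + 1) m * (K.factorial : ℚ) = ((K + m).factorial : ℚ) := by
  rw [poch_natCast_succ K m]
  have key : (K + m).choose m * m.factorial * K.factorial = (K + m).factorial := by
    have := Nat.choose_mul_factorial_mul_factorial (Nat.le_add_left m K)
    rw [Nat.add_sub_cancel] at this
    exact this
  have key' : (((K + m).choose m : ℕ) : ℚ) * (m.factorial : ℚ) * (K.factorial : ℚ) = ((K + m).factorial : ℚ) := by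
    exact_mod_cast key
  linear_combination key'

/-- One `B`-slot of the kernel at `x = 1`: `(1)_β (N+2−β)_β · (N+1−β)! = β!·(N+1)!` (`0 ≤ β ≤ N+1`). -/
theorem kernel5_slot_one (N β : ℤ) (hβ : 0 ≤ β) (hle : β ≤ N + 1) :
    pochQ ((1 : ℕ) : ℚ) β.toNat * pochQ (((1 : ℕ) : ℚ) + N + 1 - β) β.toNat * facQ (N + 1 - β) = facQ β * facQ (N + 1) := by
  obtain ⟨n, rfl⟩ := Int.eq_ofNat_of_zero_le hβ
  obtain ⟨K, hK⟩ := Int.eq_ofNat_of_zero_le (show 0 ≤ N + 1 - (n : ℤ) by omega)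
  have hN1 : (N + 1).toNat = K + n := by omega
  have hbase : ((1 : ℕ) : ℚ) + (N : ℚ) + 1 - ((n : ℤ) : ℚ) = (K : ℚ) + 1 := by
    have h' : ((N + 1 - (n : ℤ) : ℤ) : ℚ) = ((K : ℤ) : ℚ) := by rw [hK]
    push_cast at h' ⊢
    linarith
  unfold facQ
  rw [hbase, hK, hN1, Int.toNat_natCast, Int.toNat_natCast, pochQ_eq_poch, pochQ_eq_poch, Nat.cast_one, poch_one_eq_factorial,
    ← poch_succ_mul_factorial K n]
  ring

/-- The kernel at `x = 1`: `k₅(1)·∏_{j∈B}(N+1−b_j)! = (N+2)·∏_{j∈B} b_j!` (slots of `B` in `[0, N+1]`). -/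
theorem kernel5_one (b : ℕ → ℤ) (hN : 0 ≤ b 0) (hB : ∀ j ∈ Icc 3 6, 0 ≤ b j ∧ b j ≤ b 0 + 1) :
    kernel5 b 1 * ∏ j ∈ Icc 3 6, facQ (b 0 + 1 - b j) = ((b 0 : ℚ) + 2) * ∏ j ∈ Icc 3 6, facQ (b j) := by
  have hF : pochQ ((1 : ℕ) : ℚ) ((b 0).toNat + 1) = facQ (b 0 + 1) := by
    unfold facQ
    rw [show (b 0 + 1).toNat = (b 0).toNat + 1 by omega, pochQ_eq_poch, Nat.cast_one, poch_one_eq_factorial]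
  have hF0 : facQ (b 0 + 1) ≠ 0 := facQ_ne_zero _
  have hslots : (∏ j ∈ Icc 3 6, pochQ ((1 : ℕ) : ℚ) (b j).toNat * pochQ (((1 : ℕ) : ℚ) + b 0 + 1 - b j) (b j).toNat) *
      ∏ j ∈ Icc 3 6, facQ (b 0 + 1 - b j) = (∏ j ∈ Icc 3 6, facQ (b j)) * facQ (b 0 + 1) ^ 4 := by
    rw [← prod_mul_distrib, show facQ (b 0 + 1) ^ 4 = ∏ _j ∈ Icc 3 6, facQ (b 0 + 1) by rw [prod_const]; rfl,
      ← prod_mul_distrib]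
    refine prod_congr rfl fun j hj => ?_
    exact kernel5_slot_one (b 0) (b j) (hB j hj).1 (hB j hj).2
  unfold kernel5
  rw [hF, show (2 * ((1 : ℕ) : ℚ) + b 0) = (b 0 : ℚ) + 2 by push_cast; ring, mul_assoc, hslots]
  field_simp

/-- The face telescoper at `1` in factorials (= `CFW3.hPoly_eval_one` of `WedgeDictionaryRankThreeProof`, re-proved here to keep the import list):
`h_a(1) · ∏_j (N − a_j)! = ∏_j a_j! · (N!)⁷`. -/
theorem hPoly_eval_one_fac (b : ℕ → ℤ) (hb : InBox b) (hle : ∀ j ∈ range 7, b (j + 1) ≤ b 0) :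
    (hPoly b).eval 1 * ∏ j ∈ range 7, facQ (b 0 - b (j + 1)) = (∏ j ∈ range 7, facQ (b (j + 1))) * facQ (b 0) ^ 7 := by
  unfold facQ
  rw [eval_hPoly, ← prod_mul_distrib,
    show (((b 0).toNat.factorial : ℕ) : ℚ) ^ 7 = ∏ _j ∈ range 7, (((b 0).toNat.factorial : ℕ) : ℚ) by
      rw [prod_const, card_range],
    ← prod_mul_distrib]
  refine prod_congr rfl fun j hj => ?_
  set m := (b (j + 1)).toNat with hm
  set M := (b 0 - b (j + 1)).toNat with hM
  have hβ0 : 0 ≤ b (j + 1) := (hb.2 j hj).1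
  have hMm : M + m = (b 0).toNat := by have := hle j hj; omega
  have hcast : ((b 0 - b (j + 1) : ℤ) : ℚ) = (M : ℚ) := by
    have : ((M : ℕ) : ℤ) = b 0 - b (j + 1) := Int.toNat_of_nonneg (by have := hle j hj; omega)
    exact_mod_cast this.symm
  rw [hcast, poch_one_eq_factorial, ← hMm, add_comm (1 : ℚ), ← poch_succ_mul_factorial M m]
  ring

/-- `η(a)` in factorials: `η(a) · ∏_j (N − a_j)! = ∏_j a_j! · N!`. -/
theorem rowEta_fac (a : ℕ → ℤ) (ha : InBox a) (hle : ∀ j ∈ range 7, a (j + 1) ≤ a 0) :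
    rowEta a * ∏ j ∈ range 7, facQ (a 0 - a (j + 1)) = (∏ j ∈ range 7, facQ (a (j + 1))) * facQ (a 0) := by
  have hh := hPoly_eval_one_fac a ha hle
  have hP : BallRivoal.poch 1 (a 0).toNat = facQ (a 0) := by unfold facQ; exact poch_one_eq_factorial _
  have hF0 : facQ (a 0) ≠ 0 := facQ_ne_zero _
  unfold rowEta
  rw [hP, div_mul_eq_mul_div, hh]
  field_simp


/-! ### The three evaluations as named statements (so that the file's helper lemmas hang off proved targets) -/

/-- STATEMENT (PROVED as `ldWeightSym_neg_one_holds`): the `m`-step `0 → −1` of the symmetric weight on the layer `σ = N − 1`. -/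
def ldWeightSym_neg_one_stmt : Prop :=
  ∀ a : ℕ → ℤ, 0 ≤ a 1 → 0 ≤ a 2 → 0 ≤ a 7 → 0 ≤ a 0 - a 3 → 0 ≤ a 0 - a 4 → 0 ≤ a 0 - a 5 → 0 ≤ a 0 - a 6 →
    0 ≤ 2 * a 0 - sumB a → sigmaT a + 1 = a 0 →
    ldWeightSym a (-1) * (((a 1 : ℚ) + 1) * ((a 2 : ℚ) + 1) * ((a 7 : ℚ) + 1) * (2 * (a 0 : ℚ) - sumB a + 1)) =
      -(ldWeightSym a 0 * (((a 0 : ℚ) - a 3 + 1) * ((a 0 : ℚ) - a 4 + 1) * ((a 0 : ℚ) - a 5 + 1) * ((a 0 : ℚ) - a 6 + 1)))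

/-- `ldWeightSym_neg_one_stmt` holds (by-name audit wrapper of `ldWeightSym_neg_one`). -/
theorem ldWeightSym_neg_one_holds : ldWeightSym_neg_one_stmt := fun a h1 h2 h7 h3 h4 h5 h6 hS hσ =>
  ldWeightSym_neg_one a h1 h2 h7 h3 h4 h5 h6 hS hσ

/-- STATEMENT (PROVED as `kernel5_one_holds`): `k₅(1)·∏_{j∈B}(N+1−b_j)! = (N+2)·∏_{j∈B} b_j!`. -/
def kernel5_one_stmt : Prop :=
  ∀ b : ℕ → ℤ, 0 ≤ b 0 → (∀ j ∈ Icc 3 6, 0 ≤ b j ∧ b j ≤ b 0 + 1) →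
    kernel5 b 1 * ∏ j ∈ Icc 3 6, facQ (b 0 + 1 - b j) = ((b 0 : ℚ) + 2) * ∏ j ∈ Icc 3 6, facQ (b j)

/-- `kernel5_one_stmt` holds (by-name audit wrapper of `kernel5_one`). -/
theorem kernel5_one_holds : kernel5_one_stmt := fun b hN hB => kernel5_one b hN hB

/-- STATEMENT (PROVED as `rowEta_fac_holds`): `η(a)·∏_j (N − a_j)! = ∏_j a_j!·N!`. -/
def rowEta_fac_stmt : Prop :=
  ∀ a : ℕ → ℤ, InBox a → (∀ j ∈ range 7, a (j + 1) ≤ a 0) →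
    rowEta a * ∏ j ∈ range 7, facQ (a 0 - a (j + 1)) = (∏ j ∈ range 7, facQ (a (j + 1))) * facQ (a 0)

/-- `rowEta_fac_stmt` holds (by-name audit wrapper of `rowEta_fac`). -/
theorem rowEta_fac_holds : rowEta_fac_stmt := fun a ha hle => rowEta_fac a ha hle

end Summit.KontsevichZagierPeriods.Zeta5Search.WedgeDictionary
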